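import Literature.Probability.RandomPlanarGeometry.HexSAWBrickWallStripFugacityWidthOneComplexFugacity
import Literature.Probability.Distributions.CharFunInversionFormula
import HarnessLib

/-!
# The law of the contact number as a lattice law: characteristic function and the inversion formula
# `P_{N,y,z}(bc = m) = (1/2π) ∫_{−π}^{π} e^{−itm} C_{1,N}(ye^{it}, z)/C_{1,N}(y,z) dt`

Topic `Literature/Probability/RandomPlanarGeometry` (continues `…WidthOneComplexFugacity.lean` — `stripZ₂C`, `charFun_finLaw`, `stripZ₂C_one_tilt_eq_sum` — and uses
`Literature/Probability/Distributions/CharFunInversionFormula.lean` — `Durrett2019_ex_3_3_2_lattice`, inversion on a lattice).  The starting identity of the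
LOCAL limit theorem for the contact number (DOOR-ap5-g28 item 1): together with the window estimates of `…WidthOneContactBerryEsseen` and the off-axis decay
of `…WidthOneOffAxisDecay` it reduces the local law of `bc` to the three-piece integral bookkeeping of Durrett's Theorem 3.5.3.

* `charFun_contactCountLaw` — the (unscaled) law of `bc` under `P_{N,y,z}` has characteristic function `C_{1,N}(ye^{it}, z)/C_{1,N}(y,z)`.
* `ae_contactCountLaw_mem_int` — it is a lattice law of span `1` (`bc ∈ ℕ`).
* ★★ `contactCount_prob_eq_integral` — for every integer `m`:
  `P_{N,y,z}(bc = m) = (1/2π)·∫_{−π}^{π} e^{−itm}·C_{1,N}(ye^{it}, z)/C_{1,N}(y,z) dt`.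

## Sources
R. Durrett, *Probability: Theory and Examples* (2019) §3.3 Exercise 3.3.2 (iii) (inversion on a lattice) and §3.5 (proof of Theorem 3.5.3, first display);
N. R. Beaton et al., CMP 326 (2014), arXiv:1109.0358v5 §3.2 Proposition 6 (p. 10: `C_{T,N}(y,z)`).  Lane statements (lane «pcv-sawmu», a-p5 g28); nothing
is quoted AS PRINTED.
-/

noncomputable section

open MeasureTheory ProbabilityTheory Filter Finset Complex Set
open Literature.Probability.LatticeModels Literature.Probability.Percolation Literature.Probability.Distributions
open scoped Real

namespace Literature.Probability.RandomPlanarGeometry.SAW.HexBW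

namespace WidthOneYZ

variable {y z : ℝ}

/-- **The characteristic function of the contact number**: for the law `Σ_q (wgt_q/C_{1,N}) δ_{bc(q)}` of `bc` under `P_{N,y,z}`,
`φ(t) = C_{1,N}(ye^{it}, z)/C_{1,N}(y,z)`. [cite: Durrett2019, §3.3 Theorem 3.3.1 (lane statement); BeatonBousquetMelouDeGierDuminilCopinGuttmann2014, §3.2 Proposition 6 (arXiv v5 p. 10)] -/
theorem charFun_contactCountLaw (hy : 0 < y) (hz : 0 < z) (N : ℕ) (t : ℝ) :
    charFun (finLaw (stripPairs 1 N) (fun q => wgt y z N q / stripZ₂ 1 N y z) (fun q => (bottomVisits₀ q.1 q.2 N : ℝ))) t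
      = stripZ₂C 1 N ((y : ℂ) * cexp ((t : ℂ) * I)) (z : ℂ) / ((stripZ₂ 1 N y z : ℝ) : ℂ) := by
  rw [charFun_finLaw _ _ (wgt_div_nonneg hy hz N), stripZ₂C_one_tilt_eq_sum, Finset.sum_div]
  refine Finset.sum_congr rfl fun q _ => ?_
  push_cast
  ring_nf

/-- The law of `bc` is carried by the integers (a lattice law of span `1`, offset `0`). [cite: Durrett2019, §3.5 (lattice distributions; lane plumbing)] -/
theorem ae_contactCountLaw_mem_int (y z : ℝ) (N : ℕ) :
    ∀ᵐ x ∂(finLaw (stripPairs 1 N) (fun q => wgt y z N q / stripZ₂ 1 N y z) (fun q => (bottomVisits₀ q.1 q.2 N : ℝ))),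
      ∃ k : ℤ, x = 0 + 1 * (k : ℝ) := by
  rw [ae_iff]
  have hmeas : MeasurableSet {x : ℝ | ¬∃ k : ℤ, x = 0 + 1 * (k : ℝ)} := by
    have : {x : ℝ | ¬∃ k : ℤ, x = 0 + 1 * (k : ℝ)} = (Set.range (fun k : ℤ => (k : ℝ)))ᶜ := by
      ext x; simp [eq_comm]
    rw [this]
    exact (Set.countable_range _).measurableSet.compl
  rw [finLaw, Measure.finsetSum_apply]
  refine Finset.sum_eq_zero fun q _ => ?_
  rw [Measure.smul_apply, Measure.dirac_apply' _ hmeas, Set.indicator_of_notMem, smul_zero]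
  simp only [Set.mem_setOf_eq, zero_add, one_mul, not_exists, not_forall, not_not]
  exact ⟨(bottomVisits₀ q.1 q.2 N : ℕ), by push_cast; ring⟩

open Classical in
/-- ★★ **THE INVERSION FORMULA FOR THE CONTACT NUMBER**: for `y, z > 0`, every `N` and every integer `m`,
`P_{N,y,z}(bc = m) = Σ_{q : bc(q) = m} wgt_q/C_{1,N}(y,z) = (1/2π)·∫_{−π}^{π} e^{−itm}·C_{1,N}(ye^{it}, z)/C_{1,N}(y,z) dt`
(Durrett's Exercise 3.3.2 (iii) on the lattice `ℤ`, span `1`).  The left window `|t| ≤ δ` is controlled by the complex two-term asymptotics, the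
complement by the off-axis decay. [cite: Durrett2019, §3.3 Exercise 3.3.2 (iii) and §3.5 proof of Theorem 3.5.3 (lane statement); BeatonBousquetMelouDeGierDuminilCopinGuttmann2014, §3.2 Proposition 6 (arXiv v5 p. 10)] -/
theorem contactCount_prob_eq_integral (hy : 0 < y) (hz : 0 < z) (N : ℕ) (m : ℤ) :
    (((∑ q ∈ (stripPairs 1 N).filter (fun q => (bottomVisits₀ q.1 q.2 N : ℝ) = m), wgt y z N q / stripZ₂ 1 N y z : ℝ) : ℂ))
      = (1 / (2 * π) : ℂ) * ∫ t in -π..π, cexp (-((t : ℂ) * (m : ℂ) * I))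
          * (stripZ₂C 1 N ((y : ℂ) * cexp ((t : ℂ) * I)) (z : ℂ) / ((stripZ₂ 1 N y z : ℝ) : ℂ)) := by
  set μ : Measure ℝ := finLaw (stripPairs 1 N) (fun q => wgt y z N q / stripZ₂ 1 N y z) (fun q => (bottomVisits₀ q.1 q.2 N : ℝ)) with hμ
  haveI : IsProbabilityMeasure μ := isProbabilityMeasure_contactLaw_aux hy hz N
  have h := Durrett2019_ex_3_3_2_lattice μ one_pos 0 (ae_contactCountLaw_mem_int y z N) m
  have hset : μ.real {(0 : ℝ) + 1 * (m : ℝ)} = ∑ q ∈ (stripPairs 1 N).filter (fun q => (bottomVisits₀ q.1 q.2 N : ℝ) = m),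
      wgt y z N q / stripZ₂ 1 N y z := by
    rw [hμ, finLaw_real_apply _ _ (wgt_div_nonneg hy hz N)]
    refine Finset.sum_congr (Finset.filter_congr fun q _ => ?_) fun _ _ => rfl
    simp
  rw [hset] at h
  have hint : (∫ t in -π..π, cexp (-((t : ℂ) * (m : ℂ) * I))
        * (stripZ₂C 1 N ((y : ℂ) * cexp ((t : ℂ) * I)) (z : ℂ) / ((stripZ₂ 1 N y z : ℝ) : ℂ)))
      = ∫ t in -(π / (1 : ℝ))..(π / (1 : ℝ)), cexp (-((t : ℂ) * (((0 : ℝ) : ℂ) + ((1 : ℝ) : ℂ) * (m : ℂ)) * I)) * charFun μ t := by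
    rw [div_one]
    refine intervalIntegral.integral_congr fun t _ => ?_
    rw [hμ, charFun_contactCountLaw hy hz N t]
    push_cast
    ring_nf
  rw [h, ← hint]
  push_cast
  ring
where
  /-- The unscaled law is a probability measure (same weights as `contactLaw`). -/
  isProbabilityMeasure_contactLaw_aux (hy : 0 < y) (hz : 0 < z) (N : ℕ) :
      IsProbabilityMeasure (finLaw (stripPairs 1 N) (fun q => wgt y z N q / stripZ₂ 1 N y z) (fun q => (bottomVisits₀ q.1 q.2 N : ℝ))) := by
    refine isProbabilityMeasure_finLaw _ _ (wgt_div_nonneg hy hz N) ?_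
    rw [← Finset.sum_div, ← stripZ₂_one_eq_sum_wgt, div_self (stripZ₂_pos 1 N hy hz).ne']

end WidthOneYZ

end Literature.Probability.RandomPlanarGeometry.SAW.HexBW

end
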